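import Literature.MathematicalPhysics.QuantumFieldTheory.Balaban1983to89.B15TreeGauge196Walks

/-!
# `Balaban1983to89.B15TreeGauge196` — T. Bałaban, *Large field renormalization. I. The basic step of the 𝐑 operation*, Commun. Math. Phys. **122** (1989) 175–202 [Balaban1989LargeFieldI]: the generalized axial gauge of pp. 195–196 — the contours `Γ_{y,x}` on a rectangular annulus `P₁ ∖ P₂` of the unit lattice (the detour around `P₂` for `x₁ > a`), TYPED as lattice words on the `ℤ^d` carriers of `B7Prop1Explicit` (PART 2/3: the contours, the pairs `Γ_{y,x}`, `Γ_{y,x+e_μ}`, and the gauge transformation `v(x) = V(Γ_{y,x})`)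

statement-level skeleton of published theorems with citation tags; proofs where landed; nothing here is a claim about the Yang–Mills mass gap

PDF held: `paper:balaban1989-cmp122-large-field-i` (journal page = PDF page + 174; pp. 195–196 = PDF pp. 21–22,
re-read AS IMAGES for this file: `run/shared/lean/pub/pub-balaban/b2b-balaban-ref1/pages/1989-cmp122-large-field-I/
…-p021-x2.png`, `…-p022-x2.png`); [Balaban1989LargeFieldII] = `paper:balaban1989-cmp122-large-field-ii` (journal page =
PDF page + 354; p. 381 = PDF p. 27, render `…1989-cmp122-large-field-II-p027-x2.png`).

WHAT IS REPRODUCED (mega-formalization `lit-balaban`, HOME `run/shared/lean/pub/lit-balaban/`, Phase-2 seat p26,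
generation 2; the file serves SKELETON row `B16.Lem@381`, whose case-1 estimate of [Balaban1989LargeFieldII] p. 382
is proved in `B16Ineq382TreeGauge` over THIS gauge).  P. 195: *"We fix a gauge which is a modification and a
generalization of the axial gauge in cubes used in the previous papers. At this point we make an essential use of the
fact that the domains Λ ⊃ Z″_k ⊃ ⋯ ⊃ Z″_{h+1} ⊃ (Ω″^{~2}_{h+1})ᶜ are rectangular parallelepipeds. … Consider two
successive rectangular parallelepipeds in the sequence, for example P₁ = [a₁,b₁] × ⋯ × [a_d,b_d] ⊃ P₂ = [a′₁,b′₁] ×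
⋯ × [a′_d,b′_d], hence [a′_μ,b′_μ] ⊂ [a_μ,b_μ]. We have to fix a gauge in P₁∖P₂, more precisely in the intersection
with the corresponding lattice. We may assume, rescaling properly, that it is the unit lattice."*  P. 196: *"We fix
the initial point y = (y₁,…,y_d) = (a₁ + 1/2, …, a_d + 1/2), and a number a ∈ (a′₁,b′₁). For a given point x of the
lattice in P₁∖P₂ we choose a contour connecting x to y. If x₁ ≦ a, then we take the usual contour Γ_{y,x} =
[y,(y₁,…,y_{d−1},x_d)] ∪ ⋯ ∪ [(y₁,x₂,…,x_d), x]. If x₁ > a, then we take the contour Γ_{y,x} = [y,(y₁,…,y_{d−1},x_d)]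
∪ ⋯ ∪ [(y₁,y₂,y₃,x₄,…,x_d),(y₁,y₂,x₃,x₄,…,x_d)] ∪ [(y₁,y₂,x₃,…,x_d),(b₁ − 1/2,y₂,x₃,…,x_d)] ∪ [(b₁ − 1/2,y₂,x₃,…,x_d),
(b₁ − 1/2,x₂,x₃,…,x_d)] ∪ [(b₁ − 1/2,x₂,x₃,…,x_d), x]. This slightly awkward definition describes a simplest family
of contours connecting points of P₁∖P₂ with the point y. The union of all the contours is a tree graph T on P₁∖P₂ …
We fix the gauge putting the bond variables equal to 1 for bonds belonging to the tree graph."*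

THE TYPING.  Lattice sites are `Site d = Fin d → ℤ` (`B7Prop1Explicit`), `d = n + 3` (the detour needs the printed
coordinates 1, 2, 3 = indices `i0, i1, i2`; [Balaban1989LargeFieldII] has `d = 4`).  In integer site coordinates the
corner site `y` of `P₁` is `lo`, the last site `b₁ − 1/2` in direction 1 is `hi i0`, and the threshold `a` becomes
the integer `τ` (`x₁ ≦ a ⇔ x i0 ≤ τ`).  `contour lo hi τ x` is the printed `Γ_{y,x}` as a lattice WORD from `lo` (the
usual contour is B5 (1.7) = `treeWord`, coordinates changed in the order `d, d−1, …, 1`; the detour = the high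
directions `highDirs`, then `detourTail`).  PROVED: `disp_contour` (the contour ends at `x`); the decompositions of
the pairs `Γ_{y,x}`, `Γ_{y,x+e_μ}` that the Stokes argument of [Balaban1989LargeFieldII] p. 382 uses (§4: both usual,
both detour with `μ = 2`, `μ ≥ 3`, `μ = 1`, and the mixed pair across the threshold); `hol_treeGauge_contour`: the
gauge transformation `v(x) = V(Γ_{y,x})` of [Balaban1989LargeFieldII] p. 381 puts ANY bond field `V` into this gauge
(`V^v(Γ_{y,x}) = 1` for all `x`).  The annulus `P₁ ∖ P₂` and "the contours stay in `P₁ ∖ P₂`" are PART 3.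

HONEST SCOPE.  Only the tree `T = ⋃ Γ_{y,x}` on ONE annulus `P₁∖P₂` is typed — not the external bonds joining the
annuli into `T₀`, not the Faddeev–Popov `δ_{T₀}(V′)`, not the tree property itself (only its consequence used on
p. 382: the gauge conditions along the contours).  No measure, no claim of [IV]/[V] is asserted; every declaration is
a definition with a body or a proved lemma of lattice combinatorics.  Unit `lit-balaban-p26`
(literature-prover-lit-balaban-p26-g2-0).
-/

noncomputable section

open scoped BigOperators

namespace Literature.MathematicalPhysics.QuantumFieldTheory.Balaban1983to89.B15TreeGauge196

open B7Prop1Explicit B8Lemma1NonAbelian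

variable {d : ℕ}

/-! ## §3 The contours `Γ_{y,x}` of p. 196 (`d = n + 3`) -/

section Contours

variable {n : ℕ}

/-- The index of the printed coordinate `1` (the direction of the threshold `a` and of the detour). [cite: Balaban1989LargeFieldI, p.196] -/
def i0 : Fin (n + 3) := ⟨0, by omega⟩

/-- The index of the printed coordinate `2`. [cite: Balaban1989LargeFieldI, p.196] -/
def i1 : Fin (n + 3) := ⟨1, by omega⟩

/-- The index of the printed coordinate `3` (used in [Balaban1989LargeFieldII] p. 382 to move a surface off `P₂`). [cite: Balaban1989LargeFieldI, p.196] -/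
def i2 : Fin (n + 3) := ⟨2, by omega⟩

/-- `i0_val` — bookkeeping. [cite: Balaban1989LargeFieldI, p.196] -/
@[simp] theorem i0_val : (i0 : Fin (n + 3)).val = 0 := rfl

/-- `i1_val` — bookkeeping. [cite: Balaban1989LargeFieldI, p.196] -/
@[simp] theorem i1_val : (i1 : Fin (n + 3)).val = 1 := rfl

/-- `i2_val` — bookkeeping. [cite: Balaban1989LargeFieldI, p.196] -/
@[simp] theorem i2_val : (i2 : Fin (n + 3)).val = 2 := rfl

/-- `i1_ne_i0` — bookkeeping. [cite: Balaban1989LargeFieldI, p.196] -/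
theorem i1_ne_i0 : (i1 : Fin (n + 3)) ≠ i0 := by simp [Fin.ext_iff]

/-- `i2_ne_i0` — bookkeeping. [cite: Balaban1989LargeFieldI, p.196] -/
theorem i2_ne_i0 : (i2 : Fin (n + 3)) ≠ i0 := by simp [Fin.ext_iff]

/-- `i2_ne_i1` — bookkeeping. [cite: Balaban1989LargeFieldI, p.196] -/
theorem i2_ne_i1 : (i2 : Fin (n + 3)) ≠ i1 := by simp [Fin.ext_iff]

/-- The directions `d, d−1, …, 3` (indices `n+2, …, 2`) in the printed (decreasing) order: the coordinates changed
first by both kinds of contours. [cite: Balaban1989LargeFieldI, p.196] -/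
def highDirs (n : ℕ) : List (Fin (n + 3)) := ((List.finRange (n + 1)).map fun κ => κ.succ.succ).reverse

/-- `mem_highDirs` — the high directions are those of index `≥ 2`. [cite: Balaban1989LargeFieldI, p.196] -/
theorem mem_highDirs {κ : Fin (n + 3)} : κ ∈ highDirs n ↔ 2 ≤ κ.val := by
  simp only [highDirs, List.mem_reverse, List.mem_map, List.mem_finRange, true_and]
  constructor
  · rintro ⟨j, rfl⟩; simp only [Fin.val_succ]; omega
  · intro h
    refine ⟨⟨κ.val - 2, by omega⟩, Fin.ext ?_⟩
    simp only [Fin.val_succ]; omega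

/-- `i0 ∉ highDirs`. [cite: Balaban1989LargeFieldI, p.196] -/
theorem i0_not_mem_highDirs : (i0 : Fin (n + 3)) ∉ highDirs n := by simp [mem_highDirs]

/-- `i1 ∉ highDirs`. [cite: Balaban1989LargeFieldI, p.196] -/
theorem i1_not_mem_highDirs : (i1 : Fin (n + 3)) ∉ highDirs n := by simp [mem_highDirs]

/-- `highDirs` has no repetition. [cite: Balaban1989LargeFieldI, p.196] -/
theorem highDirs_nodup : (highDirs n).Nodup := by
  refine List.nodup_reverse.mpr ((List.nodup_finRange _).map fun a b h => ?_)
  simpa using h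

/-- `|highDirs n| = n + 1`. [cite: Balaban1989LargeFieldI, p.196] -/
@[simp] theorem length_highDirs : (highDirs n).length = n + 1 := by simp [highDirs]

/-- The full decreasing list of directions `d, …, 1` (that of `treeWord`) is `highDirs ++ [2, 1]` (indices `[i1, i0]`). [cite: Balaban1989LargeFieldI, p.196] -/
theorem finRange_reverse_eq : (List.finRange (n + 3)).reverse = highDirs n ++ [i1, i0] := by
  have h0 : (0 : Fin (n + 3)) = i0 := Fin.ext (by simp)
  have h1 : (Fin.succ (0 : Fin (n + 2)) : Fin (n + 3)) = i1 := Fin.ext (by simp)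
  rw [List.finRange_succ, List.finRange_succ, highDirs, List.map_cons, List.reverse_cons, List.reverse_cons,
    List.map_map, h0, h1, List.append_assoc]
  rfl

/-- The full list of directions has no repetition. [cite: Balaban1989LargeFieldI, p.196] -/
theorem finRange_reverse_nodup : ((List.finRange (n + 3)).reverse).Nodup :=
  List.nodup_reverse.mpr (List.nodup_finRange _)

/-- The usual contour splits as: high directions, then direction `2`, then direction `1`. [cite: Balaban1989LargeFieldI, p.196] -/
theorem treeWord_eq (v : Site (n + 3)) :
    treeWord v = tw (highDirs n) v ++ seg i1 (v i1) ++ seg i0 (v i0) := by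
  rw [treeWord_eq_tw, finRange_reverse_eq, tw_append, tw_cons, tw_cons, tw_nil, List.append_nil,
    List.append_assoc]

/-- The three straight pieces of the detour contour after the high directions: `[(y₁,y₂,x₃,…),(b₁−1/2,y₂,x₃,…)]
∪ [(b₁−1/2,y₂,x₃,…),(b₁−1/2,x₂,x₃,…)] ∪ [(b₁−1/2,x₂,…), x]`. [cite: Balaban1989LargeFieldI, p.196] -/
def detourTail (lo hi x : Site (n + 3)) : List (Letter (n + 3)) :=
  seg i0 (hi i0 - lo i0) ++ seg i1 (x i1 - lo i1) ++ seg i0 (x i0 - hi i0)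

/-- **The contour `Γ_{y,x}` of p. 196** as a lattice word from the corner site `y = lo` of `P₁`: the usual contour
(`treeWord`, B5 (1.7)) if `x₁ ≦ a` (`x i0 ≤ τ`), the detour around `P₂` through the far face `x₁ = b₁ − 1/2`
(`hi i0`) if `x₁ > a`. [cite: Balaban1989LargeFieldI, p.196] -/
def contour (lo hi : Site (n + 3)) (τ : ℤ) (x : Site (n + 3)) : List (Letter (n + 3)) :=
  if x i0 ≤ τ then treeWord (x - lo) else tw (highDirs n) (x - lo) ++ detourTail lo hi x

variable {lo hi x : Site (n + 3)} {τ : ℤ}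

/-- `contour_of_le` — the case `x₁ ≦ a`. [cite: Balaban1989LargeFieldI, p.196] -/
theorem contour_of_le (h : x i0 ≤ τ) : contour lo hi τ x = treeWord (x - lo) := if_pos h

/-- `contour_of_not_le` — the case `x₁ > a`. [cite: Balaban1989LargeFieldI, p.196] -/
theorem contour_of_not_le (h : ¬ x i0 ≤ τ) :
    contour lo hi τ x = tw (highDirs n) (x - lo) ++ detourTail lo hi x := if_neg h

/-- The detour pieces end at `x` too: net displacement `(x₁ − y₁)e₁ + (x₂ − y₂)e₂`. [cite: Balaban1989LargeFieldI, p.196] -/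
theorem disp_detourTail : disp (detourTail lo hi x) = (x i0 - lo i0) • e i0 + (x i1 - lo i1) • e i1 := by
  rw [detourTail, disp_append, disp_append, disp_seg, disp_seg, disp_seg,
    show (hi i0 - lo i0) • (e i0 : Site (n + 3)) + (x i1 - lo i1) • e i1 + (x i0 - hi i0) • e i0
      = ((hi i0 - lo i0) + (x i0 - hi i0)) • e i0 + (x i1 - lo i1) • e i1 by rw [add_smul]; abel]
  congr 2; ring

/-- Both contours end at `x`: `disp Γ_{y,x} = x − y`. [cite: Balaban1989LargeFieldI, p.196] -/
theorem disp_contour : disp (contour lo hi τ x) = x - lo := by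
  by_cases h : x i0 ≤ τ
  · rw [contour_of_le h, disp_treeWord]
  · rw [contour_of_not_le h, disp_append, disp_tw highDirs_nodup, disp_detourTail]
    funext κ
    simp only [Pi.add_apply, Pi.sub_apply, zsmul_e_apply]
    by_cases h2 : 2 ≤ κ.val
    · have hκ0 : κ ≠ i0 := fun h => by rw [h, i0_val] at h2; omega
      have hκ1 : κ ≠ i1 := fun h => by rw [h, i1_val] at h2; omega
      rw [restrict_apply_of_mem (mem_highDirs.mpr h2), if_neg hκ0, if_neg hκ1, Pi.sub_apply]; ring
    · rw [restrict_apply_of_not_mem (fun h => h2 (mem_highDirs.mp h))]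
      rcases Nat.lt_succ_iff.mp (not_le.mp h2) |>.eq_or_lt with h1 | h0
      · have : κ = i1 := Fin.ext h1
        subst this; rw [if_neg i1_ne_i0, if_pos rfl]; ring
      · have : κ = i0 := Fin.ext (by rw [i0_val]; omega)
        subst this; rw [if_pos rfl, if_neg i1_ne_i0.symm]; ring

end Contours

/-! ## §4 The pairs `Γ_{y,x}`, `Γ_{y,x+e_μ}`: common prefix and the remaining pieces -/

section Pairs

variable {n : ℕ}

/-- Splitting a tree word at a listed direction. [cite: Balaban1989LargeFieldI, p.196] -/
theorem tw_split {ks K₁ K₂ : List (Fin d)} {μ : Fin d} (h : ks = K₁ ++ μ :: K₂) (v : Site d) :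
    tw ks v = tw K₁ v ++ seg μ (v μ) ++ tw K₂ v := by
  rw [h, tw_append, tw_cons, List.append_assoc]

/-- The tree word of `v + e_μ`: one more step in the `μ`-segment, the other pieces unchanged. [cite: Balaban1989LargeFieldI, p.196] -/
theorem tw_split_add_e {ks K₁ K₂ : List (Fin d)} {μ : Fin d} (h : ks = K₁ ++ μ :: K₂) (hnd : ks.Nodup)
    (v : Site d) : tw ks (v + e μ) = tw K₁ v ++ seg μ (v μ + 1) ++ tw K₂ v := by
  rw [h] at hnd
  have h1 : μ ∉ K₁ := fun hm => by
    have := List.nodup_append.mp hnd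
    exact (this.2.2 μ hm μ (by simp)) rfl
  have h2 : μ ∉ K₂ := (List.nodup_cons.mp (List.nodup_append.mp hnd).2.1).1
  have e1 : tw K₁ (v + e μ) = tw K₁ v := tw_congr fun κ hκ => by
    have : κ ≠ μ := fun h => h1 (h ▸ hκ)
    simp [e_apply, this]
  have e2 : tw K₂ (v + e μ) = tw K₂ v := tw_congr fun κ hκ => by
    have : κ ≠ μ := fun h => h2 (h ▸ hκ)
    simp [e_apply, this]
  rw [tw_split h, e1, e2]
  simp [e_apply]

/-- One more forward step: `seg κ (m+1) = seg κ m ++ [+e_κ]` for `m ≥ 0`. [cite: Balaban1989LargeFieldI, p.196] -/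
theorem seg_add_one_of_nonneg (κ : Fin d) {m : ℤ} (hm : 0 ≤ m) : seg κ (m + 1) = seg κ m ++ [(κ, true)] := by
  obtain ⟨k, rfl⟩ := Int.eq_ofNat_of_zero_le hm
  rw [show (k : ℤ) + 1 = ((k + 1 : ℕ) : ℤ) by push_cast; ring, seg_natCast, seg_natCast, List.replicate_succ']

/-- One more backward step: `seg κ (m−1) = seg κ m ++ [−e_κ]` for `m ≤ 0`. [cite: Balaban1989LargeFieldI, p.196] -/
theorem seg_sub_one_of_nonpos (κ : Fin d) {m : ℤ} (hm : m ≤ 0) : seg κ (m - 1) = seg κ m ++ [(κ, false)] := by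
  obtain ⟨k, hk⟩ := Int.eq_ofNat_of_zero_le (neg_nonneg.mpr hm)
  have : m = -(k : ℤ) := by rw [← hk, neg_neg]
  subst this
  rw [show -(k : ℤ) - 1 = -((k + 1 : ℕ) : ℤ) by push_cast; ring, seg_neg_natCast, seg_neg_natCast,
    List.replicate_succ']

variable {lo hi x : Site (n + 3)} {τ : ℤ}

/-- **Pair, both usual** (`x₁ ≦ a`, `x₁ + δ_{μ1} ≦ a`): `Γ_{y,x} = c ∪ u`, `Γ_{y,x+e_μ} = c ∪ [+e_μ] ∪ (u + e_μ)` with `c`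
the part through the `μ`-segment and `u` the lower coordinates. [cite: Balaban1989LargeFieldI, p.196] -/
theorem contour_pair_usual {μ : Fin (n + 3)} {K₁ K₂ : List (Fin (n + 3))}
    (hK : (List.finRange (n + 3)).reverse = K₁ ++ μ :: K₂) (hx : x i0 ≤ τ) (hx' : (x + e μ) i0 ≤ τ)
    (hv : 0 ≤ (x - lo) μ) :
    contour lo hi τ x = (tw K₁ (x - lo) ++ seg μ ((x - lo) μ)) ++ tw K₂ (x - lo) ∧
    contour lo hi τ (x + e μ) = (tw K₁ (x - lo) ++ seg μ ((x - lo) μ)) ++ (μ, true) :: tw K₂ (x - lo) := by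
  refine ⟨by rw [contour_of_le hx, treeWord_eq_tw, tw_split hK], ?_⟩
  rw [contour_of_le hx', treeWord_eq_tw, show x + e μ - lo = (x - lo) + e μ by abel,
    tw_split_add_e hK finRange_reverse_nodup, seg_add_one_of_nonneg μ hv]
  simp

/-- **Pair, both detour, `μ = 2`** (`i1`): `c` = everything up to the `2`-segment on the far face, `u` = the way back
in direction `1`. [cite: Balaban1989LargeFieldI, p.196] -/
theorem contour_pair_detour_i1 (hx : ¬ x i0 ≤ τ) (hv : 0 ≤ (x - lo) i1) :
    contour lo hi τ x = (tw (highDirs n) (x - lo) ++ seg i0 (hi i0 - lo i0) ++ seg i1 (x i1 - lo i1)) ++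
        seg i0 (x i0 - hi i0) ∧
    contour lo hi τ (x + e i1) = (tw (highDirs n) (x - lo) ++ seg i0 (hi i0 - lo i0) ++ seg i1 (x i1 - lo i1)) ++
        (i1, true) :: seg i0 (x i0 - hi i0) := by
  have hx' : ¬ (x + e i1 : Site (n + 3)) i0 ≤ τ := by simpa [e_apply, i1_ne_i0.symm] using hx
  refine ⟨by rw [contour_of_not_le hx, detourTail, List.append_assoc, List.append_assoc, List.append_assoc], ?_⟩
  have e1 : tw (highDirs n) (x + e i1 - lo) = tw (highDirs n) (x - lo) := tw_congr fun κ hκ => by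
    have : κ ≠ i1 := fun h => i1_not_mem_highDirs (h ▸ hκ)
    simp [e_apply, this]
  have hv' : 0 ≤ x i1 - lo i1 := by simpa using hv
  rw [contour_of_not_le hx', e1, detourTail]
  simp only [Pi.add_apply, e_apply, if_true, i1_ne_i0.symm, if_false, add_zero]
  rw [show x i1 + 1 - lo i1 = (x i1 - lo i1) + 1 by ring, seg_add_one_of_nonneg i1 hv']
  simp

/-- The detour pieces do not see the high coordinates. [cite: Balaban1989LargeFieldI, p.196] -/
theorem detourTail_add_e_high {μ : Fin (n + 3)} (hμ : μ ∈ highDirs n) :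
    detourTail lo hi (x + e μ) = detourTail lo hi x := by
  have h0 : i0 ≠ μ := fun h => i0_not_mem_highDirs (h ▸ hμ)
  have h1 : i1 ≠ μ := fun h => i1_not_mem_highDirs (h ▸ hμ)
  simp [detourTail, e_apply, h0, h1]

/-- **Pair, both detour, `μ ≥ 3`** (a high direction): `c` = the high part through the `μ`-segment, `u` = the lower
high directions and the three detour pieces. [cite: Balaban1989LargeFieldI, p.196] -/
theorem contour_pair_detour_high {μ : Fin (n + 3)} {H₁ H₂ : List (Fin (n + 3))}
    (hH : highDirs n = H₁ ++ μ :: H₂) (hx : ¬ x i0 ≤ τ) (hv : 0 ≤ (x - lo) μ) :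
    contour lo hi τ x = (tw H₁ (x - lo) ++ seg μ ((x - lo) μ)) ++ (tw H₂ (x - lo) ++ detourTail lo hi x) ∧
    contour lo hi τ (x + e μ) = (tw H₁ (x - lo) ++ seg μ ((x - lo) μ)) ++
        (μ, true) :: (tw H₂ (x - lo) ++ detourTail lo hi x) := by
  have hμ : μ ∈ highDirs n := by rw [hH]; simp
  have h0 : i0 ≠ μ := fun h => i0_not_mem_highDirs (h ▸ hμ)
  have hx' : ¬ (x + e μ : Site (n + 3)) i0 ≤ τ := by simpa [e_apply, h0] using hx
  refine ⟨by rw [contour_of_not_le hx, tw_split hH, List.append_assoc], ?_⟩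
  rw [contour_of_not_le hx', show x + e μ - lo = (x - lo) + e μ by abel, tw_split_add_e hH highDirs_nodup,
    seg_add_one_of_nonneg μ hv, detourTail_add_e_high hμ]
  simp

/-- **Pair, both detour, `μ = 1`** (`i0`): the bond is the last bond of the longer contour traversed backwards,
`Γ_{y,x} = Γ_{y,x+e₁} ∪ [x+e₁, x]`. [cite: Balaban1989LargeFieldI, p.196] -/
theorem contour_pair_detour_i0 (hx : ¬ x i0 ≤ τ) (hle : x i0 + 1 ≤ hi i0) :
    contour lo hi τ x = contour lo hi τ (x + e i0) ++ [(i0, false)] := by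
  have hx' : ¬ (x + e i0 : Site (n + 3)) i0 ≤ τ := by
    simp only [Pi.add_apply, e_apply_self]; omega
  have e1 : tw (highDirs n) (x + e i0 - lo) = tw (highDirs n) (x - lo) := tw_congr fun κ hκ => by
    have : κ ≠ i0 := fun h => i0_not_mem_highDirs (h ▸ hκ)
    simp [e_apply, this]
  rw [contour_of_not_le hx, contour_of_not_le hx', e1, detourTail, detourTail]
  simp only [Pi.add_apply, e_apply, if_true, i1_ne_i0, if_false, add_zero, List.append_assoc]
  rw [show x i0 - hi i0 = (x i0 + 1 - hi i0) - 1 by ring, seg_sub_one_of_nonpos i0 (by omega)]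

/-- **Pair, mixed** (`x₁ = a`'s last site: `x i0 = τ`, so `x + e₁` takes the detour): after the common high part the
two contours are `[2-segment, 1-segment]` and `[1-segment to the far face, 2-segment, 1-segment back]`.
[cite: Balaban1989LargeFieldI, p.196] -/
theorem contour_pair_mixed (hx : x i0 = τ) :
    contour lo hi τ x = tw (highDirs n) (x - lo) ++ (seg i1 (x i1 - lo i1) ++ seg i0 (x i0 - lo i0)) ∧
    contour lo hi τ (x + e i0) = tw (highDirs n) (x - lo) ++
        (seg i0 (hi i0 - lo i0) ++ seg i1 (x i1 - lo i1) ++ seg i0 (x i0 + 1 - hi i0)) := by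
  have hx' : ¬ (x + e i0 : Site (n + 3)) i0 ≤ τ := by
    simp only [Pi.add_apply, e_apply_self]; omega
  have e1 : tw (highDirs n) (x + e i0 - lo) = tw (highDirs n) (x - lo) := tw_congr fun κ hκ => by
    have : κ ≠ i0 := fun h => i0_not_mem_highDirs (h ▸ hκ)
    simp [e_apply, this]
  refine ⟨by rw [contour_of_le hx.le, treeWord_eq, List.append_assoc]; rfl, ?_⟩
  rw [contour_of_not_le hx', e1, detourTail]
  simp [e_apply, i1_ne_i0]

end Pairs

/-! ## §6 The gauge transformation `v(x) = V(Γ_{y,x})` puts any `V` in the gauge ([V] p. 381) -/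

section Gauge

variable {n : ℕ} {G : Type*} [Group G]

/-- [Balaban1989LargeFieldII] p. 381: "the gauge transformation v … is given by v(x) = V₀(Γ_{y,x}), where the contour
Γ_{y,x} was defined in Sect. 1 [IV]" — for the tree `T` of p. 196 and a bond field `V` on `ℤ^d`. [cite: Balaban1989LargeFieldI, p.196] -/
def treeGaugeFn (V : Site (n + 3) → Fin (n + 3) → G) (lo hi : Site (n + 3)) (τ : ℤ) : Site (n + 3) → G :=
  fun x => hol V lo (contour lo hi τ x)

/-- The contour of the corner itself is empty (`y₁ ≦ a`). [cite: Balaban1989LargeFieldI, p.196] -/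
theorem contour_self {lo hi : Site (n + 3)} {τ : ℤ} (hlo : lo i0 ≤ τ) : contour lo hi τ lo = [] := by
  rw [contour_of_le hlo, sub_self, treeWord_zero]

/-- **`V^v` satisfies the axial gauge conditions of p. 196**: `V^v(Γ_{y,x}) = 1` for every `x` ([V] p. 381: "We obtain
the field V₁ = V″^v …, which satisfies … the axial gauge conditions"). [cite: Balaban1989LargeFieldI, p.196] -/
theorem hol_treeGauge_contour (V : Site (n + 3) → Fin (n + 3) → G) {lo hi : Site (n + 3)} {τ : ℤ}
    (hlo : lo i0 ≤ τ) (x : Site (n + 3)) :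
    hol (gaugeAct (treeGaugeFn V lo hi τ) V) lo (contour lo hi τ x) = 1 := by
  rw [hol_gaugeAct, disp_contour, add_sub_cancel, treeGaugeFn, treeGaugeFn, contour_self hlo, hol_nil, one_mul,
    mul_inv_cancel]

end Gauge

end Literature.MathematicalPhysics.QuantumFieldTheory.Balaban1983to89.B15TreeGauge196
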